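import Summits.Ventures.PercRepro.S1CoreCapEightThree
import Summits.Ventures.PercRepro.S1CoreCapEightFour

/-!
# PercRepro — TOWARDS `Q*(8)`: FOUR BIG LINES WITH A TRIANGLE (p1, gen 27)

Half of `FourBigBound₈`. Four big lines at nullity `8` are four simple 4-point lines with no fat point, and every
other line is a fat-free transversal inside their union (`S1CoreCapEightFour`). If three of them form a
TRIANGLE — `lineRank [L₃, L₂, L₁] ≤ 3` — drop the fourth line: what remains is a configuration of the spec with
three big lines in a plane and ALL WEIGHTS `1`, whose cap is `≤ 19` (`sum_cap_le_nineteen_of_three_big_plane_simple`: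
the `f₀ = 0` row of `sum_cap_le_twenty_two_of_three_big_plane` — `12 + 4` transversals `+ 3` outside), so the
whole configuration has cap `≤ 4 + 19 = 23` (`four_big_bound_of_triangle`). The other half — four big lines
with no triangle admit no transversal at all — is open. `proofs/P1-S4-CAPBRIDGE.md` §19 (B). Axioms: standard.
-/

namespace PercRepro

namespace S1

namespace FourCap

namespace Eight

open Seven

variable {β : Type} [DecidableEq β]

omit [DecidableEq β] in
/-- A set without fat points has all its weights `1` when the weights are `1` or `2`. -/
theorem weight_one_of_fat_eq_zero {w : β → ℕ} {S : Finset β} (hw : ∀ v ∈ S, w v = 1 ∨ w v = 2)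
    (hf : fat w S = 0) : ∀ v ∈ S, w v = 1 := by
  intro v hv
  rcases hw v hv with h | h
  · exact h
  · exfalso
    have : v ∈ S.filter (fun u => w u = 2) := Finset.mem_filter.2 ⟨hv, h⟩
    unfold fat at hf
    rw [Finset.card_eq_zero] at hf
    rw [hf] at this
    exact Finset.notMem_empty v this

section ThreeBigSimple

variable {w : β → ℕ} {ls : Finset (Finset β)}
  (h1 : ∀ L ∈ ls, ∀ v ∈ L, w v = 1 ∨ w v = 2)
  (h2 : ∀ L ∈ ls, 3 ≤ L.card ∧ wsum w L ≤ 5)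
  (h3 : ∀ L ∈ ls, ∀ L' ∈ ls, L ≠ L' → (L ∩ L').card ≤ 1)
  (h4 : ∀ l : List (Finset β), l.Nodup → (∀ L ∈ l, L ∈ ls) → wsum w (unionL l) ≤ 8 + lineRank l)
  (h5 : ∀ l : List (Finset β), l.Nodup → (∀ L ∈ l, L ∈ ls) → lineRank l ≤ 3 → (unionL l).card ≤ 9)
  {L₁ L₂ L₃ : Finset β} (hL₁ : L₁ ∈ ls) (hL₂ : L₂ ∈ ls) (hL₃ : L₃ ∈ ls)
  (h12 : L₂ ≠ L₁) (h13 : L₃ ≠ L₁) (h23 : L₃ ≠ L₂)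
  (c1 : 4 ≤ L₁.card) (c2 : 4 ≤ L₂.card) (c3 : 4 ≤ L₃.card)
  (hrest : ∀ L ∈ ls, L ≠ L₁ → L ≠ L₂ → L ≠ L₃ → L.card = 3)

include h1 h2 h3 h4 h5 hL₁ hL₂ hL₃ h12 h13 h23 c1 c2 c3 hrest in
/-- **Three big lines in a plane, all weights `1`: cap sum `≤ 19`** — the triangle, its at most four
transversals, and the thin family outside at budget `2`. -/
theorem sum_cap_le_nineteen_of_three_big_plane_simple (hw : ∀ L ∈ ls, ∀ v ∈ L, w v = 1)
    (hr : lineRank [L₃, L₂, L₁] ≤ 3) : ∑ L ∈ ls, capPaper L.card (fat w L) ≤ 19 := by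
  have h2' := two_le_card_of_spec₇ h2
  obtain ⟨l, hnd, hls, hr', hsub, hmax⟩ := exists_plane ls _ [L₃, L₂, L₁] le_rfl (by simp [h12, h13, h23])
    (by simp [hL₁, hL₂, hL₃]) hr
  have hc9 : (unionL l).card ≤ 9 := card_plane_le_nine h5 hnd hls hr'
  obtain ⟨hU, hc, k1, k2, k3, e21, e3⟩ := Seven.plane_of_three_big h3 hL₁ hL₂ hL₃ h12 h13 h23 c1 c2 c3
    (hsub L₁ (by simp)) (hsub L₂ (by simp)) (hsub L₃ (by simp)) hc9
  -- no fat points anywhere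
  have hf0 : fat w (unionL l) = 0 := fat_eq_zero_of_weight_one (fun v hv => by
    obtain ⟨L, hL, hvL⟩ := mem_unionL_iff.1 hv
    exact hw L (hls L hL) v hvL)
  have hfatin := Seven.sum_fat_plane_le' w l (fun L hL => (h2 L (hls L hL)).1)
    (fun L hL L' hL' hne => h3 L (hls L hL) L' (hls L' hL') hne) (fun p hp => by
      rw [hU] at hp
      rcases Finset.mem_union.1 hp with h | h
      · exact ⟨L₃, hsub L₃ (by simp), h, c3⟩
      rcases Finset.mem_union.1 h with h | h
      · exact ⟨L₂, hsub L₂ (by simp), h, c2⟩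
      · exact ⟨L₁, hsub L₁ (by simp), h, c1⟩)
  rw [hc, hf0] at hfatin
  have hcs := wsum_unionL_eq w l (fun L hL => h1 L (hls L hL)) (fun L hL => h2' L (hls L hL))
  rw [wsum_eq_card_add_fat w (unionL l) (fun v hv => by
    obtain ⟨L, hL, hvL⟩ := mem_unionL_iff.1 hv
    exact h1 L (hls L hL) v hvL)] at hcs
  have hcost : (unionL l).card + fat w (unionL l) ≤ 11 := by
    have hb := costSum_le h1 h2' h4 l hnd hls
    omega
  -- the thin family outside
  set T := ls.filter (fun L => L ∉ l) with hT
  have hTmem : ∀ L ∈ T, L ∈ ls ∧ L ∉ l := fun L hL => Finset.mem_filter.1 hL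
  have hT3 : ∀ L ∈ T, L.card = 3 := fun L hL => hrest L (hTmem L hL).1
    (fun h => (hTmem L hL).2 (h ▸ hsub L₁ (by simp))) (fun h => (hTmem L hL).2 (h ▸ hsub L₂ (by simp)))
    (fun h => (hTmem L hL).2 (h ▸ hsub L₃ (by simp)))
  have hk : ∀ t : List (Finset β), t.Nodup → (∀ L ∈ t, L ∈ T) →
      freeCountR (unionL l) t + fat w (unionLR (unionL l) t \ unionL l) ≤
        11 - (unionL l).card - fat w (unionL l) := by
    intro t hndt hlt
    have hb := budget_of_prefix h1 h2' h4 l t (by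
      rw [List.nodup_append']
      exact ⟨hndt, hnd, fun L hLt hLl => (hTmem L (hlt L hLt)).2 hLl⟩)
      (fun L hL => by
        rcases List.mem_append.1 hL with hL | hL
        · exact (hTmem L (hlt L hL)).1
        · exact hls L hL)
      (fun L hL => hT3 L (hlt L hL))
    have hsplit := fat_sdiff_add_fat_of_subset w (subset_unionLR (unionL l) t)
    omega
  have hthin := two_mul_sum_cap_thin_le w (unionL l) T
    (fun L hL => ⟨hT3 L hL, hmax L (hTmem L hL).1 (hTmem L hL).2⟩)
    (fun L hL L' hL' hne => h3 L (hTmem L hL).1 L' (hTmem L' hL').1 hne)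
    (fun L hL => h1 L (hTmem L hL).1) (fun L hL => (h2 L (hTmem L hL).1).2) hk
  rw [hc, hf0] at hthin hcost
  -- the plane: the three big lines and the transversals
  set S := ((l.toFinset.erase L₁).erase L₂).erase L₃ with hS
  have hSmem : ∀ X ∈ S, X ∈ l ∧ X ≠ L₁ ∧ X ≠ L₂ ∧ X ≠ L₃ := fun X hX => by
    have h3' := Finset.mem_erase.1 hX
    have h2'' := Finset.mem_erase.1 h3'.2
    have h1' := Finset.mem_erase.1 h2''.2
    exact ⟨List.mem_toFinset.1 h1'.2, h1'.1, h2''.1, h3'.1⟩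
  have hS4 : S.card ≤ 4 := Seven.card_transversals_le_four h3 hL₁ hL₂ hL₃ h13 h23 k1 k2 e21 e3 S
    (fun X hX => by
      obtain ⟨hXl, hX1, hX2, hX3⟩ := hSmem X hX
      refine ⟨hls X hXl, hX1, hX2, hX3, hrest X (hls X hXl) hX1 hX2 hX3, ?_⟩
      rw [← hU]
      exact fun v hv => mem_unionL_iff.2 ⟨X, hXl, hv⟩)
  -- the sum over the plane
  have hsplit := Finset.sum_filter_add_sum_filter_not ls (fun L => L ∈ l) (fun L => capPaper L.card (fat w L))
  have hfil : ls.filter (fun L => L ∈ l) = l.toFinset := by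
    ext L
    simp only [Finset.mem_filter, List.mem_toFinset]
    exact ⟨fun h => h.2, fun h => ⟨hls L h, h⟩⟩
  rw [hfil, ← hT] at hsplit
  rw [← hsplit]
  have hL₁l : L₁ ∈ l.toFinset := List.mem_toFinset.2 (hsub L₁ (by simp))
  have hL₂l : L₂ ∈ (l.toFinset.erase L₁) := Finset.mem_erase.2 ⟨h12, List.mem_toFinset.2 (hsub L₂ (by simp))⟩
  have hL₃l : L₃ ∈ ((l.toFinset.erase L₁).erase L₂) :=
    Finset.mem_erase.2 ⟨h23, Finset.mem_erase.2 ⟨h13, List.mem_toFinset.2 (hsub L₃ (by simp))⟩⟩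
  have hcap4 : ∀ L ∈ ls, L.card = 4 → capPaper L.card (fat w L) = 4 + fat w L := by
    intro L hL hc4
    have := wsum_eq_card_add_fat w L (h1 L hL)
    have := (h2 L hL).2
    rw [hc4, Seven.capPaper_four_eq (by omega)]
  have hcap3 : ∀ X ∈ S, capPaper X.card (fat w X) = 1 + fat w X := by
    intro X hX
    obtain ⟨hXl, hX1, hX2, hX3⟩ := hSmem X hX
    have hXls := hls X hXl
    have := wsum_eq_card_add_fat w X (h1 X hXls)
    have := (h2 X hXls).2
    have hXc := hrest X hXls hX1 hX2 hX3
    rw [hXc, capPaper_three_eq' (by omega)]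
  have esum : ∀ f : Finset β → ℕ, ∑ L ∈ l.toFinset, f L = f L₁ + (f L₂ + (f L₃ + ∑ X ∈ S, f X)) := by
    intro f
    rw [← Finset.add_sum_erase _ f hL₁l, ← Finset.add_sum_erase _ f hL₂l, ← Finset.add_sum_erase _ f hL₃l]
  rw [esum, hcap4 L₁ hL₁ k1, hcap4 L₂ hL₂ k2, hcap4 L₃ hL₃ k3, Finset.sum_congr rfl hcap3,
    Finset.sum_add_distrib, Finset.sum_const_nat (m := 1) (fun _ _ => rfl), Nat.mul_one]
  rw [esum] at hfatin
  omega

end ThreeBigSimple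

section FourBigTriangle

variable {w : β → ℕ} {ls : Finset (Finset β)}
  (h1 : ∀ L ∈ ls, ∀ v ∈ L, w v = 1 ∨ w v = 2)
  (h2 : ∀ L ∈ ls, 3 ≤ L.card ∧ wsum w L ≤ 5)
  (h3 : ∀ L ∈ ls, ∀ L' ∈ ls, L ≠ L' → (L ∩ L').card ≤ 1)
  (h4 : ∀ l : List (Finset β), l.Nodup → (∀ L ∈ l, L ∈ ls) → wsum w (unionL l) ≤ 8 + lineRank l)
  (h5 : ∀ l : List (Finset β), l.Nodup → (∀ L ∈ l, L ∈ ls) → lineRank l ≤ 3 → (unionL l).card ≤ 9)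
  {L₁ L₂ L₃ L₄ : Finset β} (hL₁ : L₁ ∈ ls) (hL₂ : L₂ ∈ ls) (hL₃ : L₃ ∈ ls) (hL₄ : L₄ ∈ ls)
  (h12 : L₂ ≠ L₁) (h13 : L₃ ≠ L₁) (h14 : L₄ ≠ L₁) (h23 : L₃ ≠ L₂) (h24 : L₄ ≠ L₂) (h34 : L₄ ≠ L₃)
  (c1 : 4 ≤ L₁.card) (c2 : 4 ≤ L₂.card) (c3 : 4 ≤ L₃.card) (c4 : 4 ≤ L₄.card)
  (hrest : ∀ L ∈ ls, L ≠ L₁ → L ≠ L₂ → L ≠ L₃ → L ≠ L₄ → L.card = 3)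

include h1 h2 h3 h4 h5 hL₁ hL₂ hL₃ hL₄ h12 h13 h14 h23 h24 h34 c1 c2 c3 c4 hrest in
/-- **Four big lines are simple and every line is fat-free**: all weights of the configuration are `1`. -/
theorem weight_one_of_four_big : (∀ L ∈ ls, ∀ v ∈ L, w v = 1) ∧ L₄.card = 4 := by
  -- the three possible last lines
  have key : ∀ (A B C D : Finset β), A ∈ ls → B ∈ ls → C ∈ ls → D ∈ ls → B ≠ A → C ≠ A → D ≠ A → C ≠ B →
      D ≠ B → D ≠ C → 4 ≤ A.card → 4 ≤ B.card → 4 ≤ C.card → 4 ≤ D.card →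
      (∀ L ∈ ls, L ≠ A → L ≠ B → L ≠ C → L ≠ D → L.card = 3) →
      (D ∩ (C ∪ (B ∪ A))).card ≤ 2 → (∀ L ∈ ls, fat w L = 0) ∧ D.card = 4 := by
    intro A B C D hA hB hC hD hBA hCA hDA hCB hDB hDC cA cB cC cD hr hlast
    obtain ⟨kA, kB, kC, kD, hf, hcost⟩ := four_big_simple h1 h2 h3 h4 hA hB hC hD hBA hCA hDA hCB hDB hDC
      cA cB cC cD hlast
    refine ⟨fun L hL => ?_, kD⟩
    by_cases hLA : L = A
    · subst hLA; exact le_antisymm (le_trans (fat_mono w (Finset.subset_union_right.trans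
        (Finset.subset_union_right.trans Finset.subset_union_right))) hf.le) (Nat.zero_le _)
    by_cases hLB : L = B
    · subst hLB; exact le_antisymm (le_trans (fat_mono w (Finset.subset_union_left.trans
        (Finset.subset_union_right.trans Finset.subset_union_right))) hf.le) (Nat.zero_le _)
    by_cases hLC : L = C
    · subst hLC; exact le_antisymm (le_trans (fat_mono w (Finset.subset_union_left.trans
        Finset.subset_union_right)) hf.le) (Nat.zero_le _)
    by_cases hLD : L = D
    · subst hLD; exact le_antisymm (le_trans (fat_mono w Finset.subset_union_left) hf.le) (Nat.zero_le _)
    exact (covered_of_four_big h1 h2 h4 hA hB hC hD hBA hCA hDA hCB hDB hDC hcost hf hL hLA hLB hLC hLD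
      (hr L hL hLA hLB hLC hLD)).2
  have hall : (∀ L ∈ ls, fat w L = 0) ∧ L₄.card = 4 := by
    rcases exists_last_le_two h3 h5 hL₁ hL₂ hL₃ hL₄ h12 h13 h14 h23 h24 h34 c1 c2 c3 c4 with h | h | h
    · exact key L₁ L₂ L₃ L₄ hL₁ hL₂ hL₃ hL₄ h12 h13 h14 h23 h24 h34 c1 c2 c3 c4 hrest h
    · obtain ⟨hf, -⟩ := key L₁ L₂ L₄ L₃ hL₁ hL₂ hL₄ hL₃ h12 h14 h13 h24 h23 h34.symm c1 c2 c4 c3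
        (fun L hL a b c d => hrest L hL a b d c) h
      refine ⟨hf, ?_⟩
      have hw4 := wsum_eq_card_add_fat w L₄ (h1 L₄ hL₄)
      have := (h2 L₄ hL₄).2
      have := hf L₄ hL₄
      -- `L₄` has no fat point; its size is `4` or `5`; the cost forces `4`
      obtain ⟨k1, k2, k3, k4, -, -⟩ := four_big_simple h1 h2 h3 h4 hL₁ hL₂ hL₄ hL₃ h12 h14 h13 h24 h23 h34.symm
        c1 c2 c4 c3 h
      exact k3
    · obtain ⟨hf, -⟩ := key L₁ L₃ L₄ L₂ hL₁ hL₃ hL₄ hL₂ h13 h14 h12 h34 h23.symm h24.symm c1 c3 c4 c2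
        (fun L hL a b c d => hrest L hL a d b c) h
      refine ⟨hf, ?_⟩
      obtain ⟨k1, k2, k3, k4, -, -⟩ := four_big_simple h1 h2 h3 h4 hL₁ hL₃ hL₄ hL₂ h13 h14 h12 h34 h23.symm
        h24.symm c1 c3 c4 c2 h
      exact k3
  exact ⟨fun L hL => weight_one_of_fat_eq_zero (h1 L hL) (hall.1 L hL), hall.2⟩

include h1 h2 h3 h4 h5 hL₁ hL₂ hL₃ hL₄ h12 h13 h14 h23 h24 h34 c1 c2 c3 c4 hrest in
/-- **Four big lines with a triangle: cap sum `≤ 23`** — if `lineRank [L₃, L₂, L₁] ≤ 3`, the configuration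
without `L₄` is a planar three-big-line configuration of weight `1`, of cap `≤ 19`, and `L₄` adds `4`. -/
theorem four_big_bound_of_triangle (hr : lineRank [L₃, L₂, L₁] ≤ 3) :
    ∑ L ∈ ls, capPaper L.card (fat w L) ≤ 23 := by
  obtain ⟨hw, k4⟩ := weight_one_of_four_big h1 h2 h3 h4 h5 hL₁ hL₂ hL₃ hL₄ h12 h13 h14 h23 h24 h34 c1 c2 c3 c4
    hrest
  -- the configuration without `L₄`
  set ls' := ls.erase L₄ with hls'
  have hmem : ∀ L ∈ ls', L ∈ ls := fun L hL => Finset.mem_of_mem_erase hL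
  have hne4 : ∀ L ∈ ls', L ≠ L₄ := fun L hL => Finset.ne_of_mem_erase hL
  have hsub := sum_cap_le_nineteen_of_three_big_plane_simple (ls := ls')
    (fun L hL => h1 L (hmem L hL)) (fun L hL => h2 L (hmem L hL))
    (fun L hL L' hL' hne => h3 L (hmem L hL) L' (hmem L' hL') hne)
    (fun l hnd hl => h4 l hnd (fun L hL => hmem L (hl L hL)))
    (fun l hnd hl => h5 l hnd (fun L hL => hmem L (hl L hL)))
    (Finset.mem_erase.2 ⟨h14.symm, hL₁⟩) (Finset.mem_erase.2 ⟨h24.symm, hL₂⟩)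
    (Finset.mem_erase.2 ⟨h34.symm, hL₃⟩) h12 h13 h23 c1 c2 c3
    (fun L hL a b c => hrest L (hmem L hL) a b c (hne4 L hL)) (fun L hL => hw L (hmem L hL)) hr
  have hsum := Finset.add_sum_erase ls (fun L => capPaper L.card (fat w L)) hL₄
  rw [← hls'] at hsum
  rw [← hsum]
  have hf4 : fat w L₄ = 0 := fat_eq_zero_of_weight_one (hw L₄ hL₄)
  rw [k4, hf4]
  obtain ⟨-, c40, -⟩ := capPaper_values
  rw [c40]
  omega

end FourBigTriangle

end Eight

end FourCap

end S1

end PercRepro
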